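import Literature.AlgebraicGeometry.Resolution.SmoothNormalizationConstants
import Literature.AlgebraicGeometry.Resolution.InseparableLocalUniformizationLemmas
import Mathlib.RingTheory.Etale.Descent
import HarnessLib

/-!
# Descent of smoothness along a smooth cover, over a field (Stacks 05B5, pointwise field case)

Topic: `Literature/AlgebraicGeometry/Resolution`. The named fact `Stacks05B5`
(`InseparableLocalUniformizationLemmas.lean`; The Stacks Project, Tag 05B5: smoothness of
`Y → S` follows from smoothness of `X → S` when `X → Y` is surjective, flat and locally of finite
presentation) is consumed in the tree only through its pointwise form
`Stacks05B5.isSmoothAt_comap` / `AreSmoothEquivalent.isSmoothAt_left'`, and in Temkin's proof of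
Thm. 4.1.1 (M. Temkin, *Inseparable local uniformization*, arXiv:0804.1554v3, Step 4, p. 49:
"`xᵢ` are still smooth-equivalent to `yᵢ` by Lemma 2.8.5 … In particular, `x₁` is `l`-smooth")
only over a FIELD `Λ = l`. We PROVE that case unconditionally:

* `isSmoothAt_comap_of_smooth_of_field` — for `A` of finite type over a field `l`, `D` a smooth
  `A`-algebra and a prime `r ⊂ D` at which `D` is `l`-smooth, `A` is `l`-smooth at `r ∩ A`.
  Proof: choose a finite purely inseparable `l₀/l` making every compositum of `κ(r ∩ A)` with
  `l₀` separable (`exists_purelyInseparable_formallySmooth_compositum`); then `l₀ ⊗_l A` is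
  `l₀`-smooth at the prime `x′` over `x = r ∩ A` (`isSmoothAt_baseChange_of_smooth_cover`:
  descent of REGULARITY along the smooth cover `l₀ ⊗ D → l₀ ⊗ A`, EGA IV₄ 17.5.8 (iii), plus
  Stacks 00TV for the separable residue field); a basic open neighbourhood `D(F)` of `x′` in the
  smooth locus may be taken of the form `D(1 ⊗ f)`, `f ∉ x` (`F^{qⁿ} ∈ 1 ⊗ A`: the base change
  is radicial), so `l₀ ⊗_l A_f` is smooth over `l₀`, and smoothness descends along the
  faithfully flat `l → l₀` (Mathlib's `Algebra.Smooth.of_smooth_tensorProduct_of_faithfullyFlat`).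
* `AreSmoothEquivalent.isSmoothAt_left_of_field'`, `AreSmoothEquivalent.isSmoothAt_left_of_field`
  — the unconditional field case of `AreSmoothEquivalent.isSmoothAt_left'`/`isSmoothAt_left`: a
  point smooth-equivalent (compatibly with the `l`-structures) to an `l`-smooth point is
  `l`-smooth (Temkin 2013, remark after Definition 2.8.1, p. 30, direction "⇒"; Step 4, p. 49).

## Sources

* The Stacks Project, Tag 05B5; Tag 00TV. A. Grothendieck, *EGA IV₄*, Prop. 17.5.8 (iii).
* M. Temkin, *Inseparable local uniformization*, arXiv:0804.1554v3, §2.8 (p. 30) and proof of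
  Thm. 4.1.1, Step 4 (p. 49).
-/

noncomputable section

namespace Literature.AlgebraicGeometry.Resolution

universe u

open IsLocalRing TensorProduct

/-- **Descent of smoothness along a smooth morphism, at a point, over a field** (The Stacks
Project, Tag 05B5, pointwise form with `S` the spectrum of a field): if `A` is of finite type
over the field `l`, `D` is a smooth `A`-algebra and `D` is `l`-smooth at the prime `r`, then `A`
is `l`-smooth at `r ∩ A`. This is the unconditional field case of `Stacks05B5.isSmoothAt_comap`.
[cite: StacksProject, Tag 05B5] -/
theorem isSmoothAt_comap_of_smooth_of_field (l : Type u) [Field l]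
    (A : Type u) [CommRing A] [Algebra l A] [Algebra.FiniteType l A]
    (D : Type u) [CommRing D] [Algebra A D] [Algebra l D] [IsScalarTower l A D]
    [Algebra.Smooth A D] (r : Ideal D) [r.IsPrime] [Algebra.IsSmoothAt l r] :
    Algebra.IsSmoothAt l (r.comap (algebraMap A D)) := by
  classical
  set x : Ideal A := r.comap (algebraMap A D) with hxdef
  haveI : Algebra.FinitePresentation l A := (Algebra.FinitePresentation.of_finiteType).mp ‹_›
  -- the residue field of `x` is finitely generated over `l`
  have hfg : (⊤ : IntermediateField l x.ResidueField).FG := by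
    haveI : Algebra.EssFiniteType l x.ResidueField :=
      Algebra.EssFiniteType.comp l A x.ResidueField
    exact IntermediateField.fg_top_iff.mpr this
  -- enlarge the constants so that every compositum of `κ(x)` with `l₀` is separable
  obtain ⟨l₀, _, _, hl₀fin, hl₀pi, hsep⟩ :=
    exists_purelyInseparable_formallySmooth_compositum l x.ResidueField hfg
  haveI := hl₀pi
  haveI : Algebra.IsAlgebraic l l₀ := inferInstance
  -- the prime `x′` of `l₀ ⊗ A` over `x`; `l₀ ⊗ A` is `l₀`-smooth there
  obtain ⟨x', hx'p, hx'⟩ := exists_prime_comap_includeRight_eq (l := l) (l' := l₀) A x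
  haveI := hx'p
  haveI : Algebra.FormallySmooth l₀ (ResidueField (Localization.AtPrime x')) :=
    formallySmooth_residueField_baseChange_of_compositum A x' x hx'.symm hsep
  haveI : Algebra.IsSmoothAt l₀ x' :=
    isSmoothAt_baseChange_of_smooth_cover l l₀ A D r x' (hx'.trans hxdef)
  -- a basic open `D(1 ⊗ f) ∋ x′` inside the smooth locus
  haveI : Algebra.FinitePresentation l₀ (l₀ ⊗[l] A) := inferInstance
  obtain ⟨F, hFx', hFsm⟩ := Algebra.IsSmoothAt.exists_notMem_smooth l₀ x'
  obtain ⟨q, hq⟩ := ExpChar.exists l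
  obtain ⟨n, f, hf⟩ := exists_pow_mem_range_includeRight A q F
  have hFpow : F ^ q ^ n = (1 : l₀) ⊗ₜ[l] f := hf.symm
  have hfx : f ∉ x := fun hfx => by
    apply hFx'
    apply hx'p.mem_of_pow_mem (q ^ n)
    rw [hFpow]
    have : f ∈ x'.comap (Algebra.TensorProduct.includeRight (R := l) (A := l₀) :
        A →ₐ[l] l₀ ⊗[l] A).toRingHom := by rw [hx']; exact hfx
    exact this
  have hsub : ↑(PrimeSpectrum.basicOpen ((1 : l₀) ⊗ₜ[l] f)) ⊆
      Algebra.smoothLocus l₀ (l₀ ⊗[l] A) := by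
    rw [← hFpow, PrimeSpectrum.basicOpen_pow _ _ (expChar_pow_pos l q n)]
    exact Algebra.basicOpen_subset_smoothLocus_iff_smooth.mpr hFsm
  have hsm1f : Algebra.Smooth l₀ (Localization.Away ((1 : l₀) ⊗ₜ[l] f)) :=
    Algebra.basicOpen_subset_smoothLocus_iff_smooth.mp hsub
  -- `l₀ ⊗ A_f ≅ (l₀ ⊗ A)_{1 ⊗ f}` is smooth over `l₀`; descend along the faithfully flat `l → l₀`
  let C := Localization.Away ((1 : l₀) ⊗ₜ[l] f)
  have hmap : (Submonoid.powers f).map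
      (Algebra.TensorProduct.includeRight (R := l) (A := l₀) : A →ₐ[l] l₀ ⊗[l] A) =
      Submonoid.powers ((1 : l₀) ⊗ₜ[l] f) := Submonoid.map_powers _ f
  haveI : IsLocalization ((Submonoid.powers f).map
      (Algebra.TensorProduct.includeRight (R := l) (A := l₀) : A →ₐ[l] l₀ ⊗[l] A)) C := by
    rw [hmap]; infer_instance
  let e : l₀ ⊗[l] Localization.Away f ≃ₐ[l₀] C :=
    IsLocalization.tensorProductEquivOfMapIncludeRight l l₀ (.powers f) (Localization.Away f) C
  haveI : Algebra.Smooth l₀ C := hsm1f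
  haveI : Algebra.Smooth l₀ (l₀ ⊗[l] Localization.Away f) := .of_equiv e.symm
  haveI : Algebra.Smooth l (Localization.Away f) :=
    Algebra.Smooth.of_smooth_tensorProduct_of_faithfullyFlat l₀
  -- hence `A` is `l`-smooth at `x`
  exact Algebra.basicOpen_subset_smoothLocus_iff_smooth.mpr ‹_›
    (show (⟨x, inferInstance⟩ : PrimeSpectrum A) ∈ (PrimeSpectrum.basicOpen f : Set _) from hfx)

namespace AreSmoothEquivalent

variable {l R₀ A B : Type u} [Field l] [CommRing R₀] [CommRing A] [CommRing B]

/-- **A point smooth-equivalent to an `l`-smooth point is `l`-smooth, over a field `l`**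
(Temkin 2013, after Definition 2.8.1, p. 30: "for a field `k` and a `k`-variety `X`, a point
`x ∈ X` is smooth-equivalent to `(Spec(k), Spec(k))` if and only if `X` is `k`-smooth at `x`",
direction "⇒"; proof of Thm. 4.1.1, Step 4, p. 49: "In particular, `x₁` is `l`-smooth"): the
unconditional field case of `AreSmoothEquivalent.isSmoothAt_left'` — `X = Spec A`, `Y = Spec B`
(`A` of finite type over the field `l`), smooth-equivalent at `x`, `y` over `S = Spec R₀` compatibly
with the `l`-structures (hypothesis `hΛ`, as in `isSmoothAt_left'`); then `Y` `l`-smooth at `y`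
implies `X` `l`-smooth at `x`.
[cite: Temkin2013, Section 2.8 (p. 30) and proof of Thm. 4.1.1 Step 4 (p. 49)] -/
theorem isSmoothAt_left_of_field' [Algebra l A] [Algebra l B] [Algebra.FiniteType l A]
    {f : R₀ →+* A} {g : R₀ →+* B} {p : Ideal A} {q : Ideal B} [p.IsPrime] [q.IsPrime]
    (h : AreSmoothEquivalent f g p q)
    (hΛ : ∀ (D : Type u) [CommRing D] [Algebra A D] [Algebra B D],
      (algebraMap A D).comp f = (algebraMap B D).comp g → Algebra.Smooth A D → Algebra.Smooth B D →
        (algebraMap A D).comp (algebraMap l A) = (algebraMap B D).comp (algebraMap l B))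
    (hq : Algebra.IsSmoothAt l q) : Algebra.IsSmoothAt l p := by
  obtain ⟨D, _, _, _, hcomp, hA, hB, r, hr, hrp, hrq⟩ := h
  -- the two `l`-structures on `D` (through `A` and through `B`) agree
  letI : Algebra l D := ((algebraMap A D).comp (algebraMap l A)).toAlgebra
  haveI : IsScalarTower l A D := IsScalarTower.of_algebraMap_eq (fun _ => rfl)
  haveI : IsScalarTower l B D := IsScalarTower.of_algebraMap_eq' (hΛ D hcomp hA hB)
  -- `D` is `l`-smooth at `r`
  haveI : Algebra.IsSmoothAt l r := by
    change Algebra.FormallySmooth l (Localization.AtPrime r)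
    haveI hqr : r.LiesOver q := ⟨hrq.symm⟩
    letI := Localization.AtPrime.algebraOfLiesOver q r
    haveI : Algebra.FormallySmooth B (Localization.AtPrime r) := inferInstance
    haveI : Algebra.FormallySmooth (Localization.AtPrime q) (Localization.AtPrime r) :=
      Algebra.FormallySmooth.localization_base (Rₘ := Localization.AtPrime q)
        (Sₘ := Localization.AtPrime r) q.primeCompl
    haveI : Algebra.FormallySmooth l (Localization.AtPrime q) := hq
    exact .comp l (Localization.AtPrime q) (Localization.AtPrime r)
  subst hrp
  exact isSmoothAt_comap_of_smooth_of_field l A D r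

/-- `isSmoothAt_left_of_field'` for `l`-algebras `R₀ → A`, `R₀ → B` (`l`-algebra maps): over a
field `l`, smooth-equivalent to an `l`-smooth point ⇒ `l`-smooth, unconditionally.
[cite: Temkin2013, Section 2.8 (p. 30)] -/
theorem isSmoothAt_left_of_field [Algebra l R₀] [Algebra l A] [Algebra l B]
    [Algebra.FiniteType l A]
    {f : R₀ →ₐ[l] A} {g : R₀ →ₐ[l] B} {p : Ideal A} {q : Ideal B} [p.IsPrime] [q.IsPrime]
    (h : AreSmoothEquivalent (f : R₀ →+* A) (g : R₀ →+* B) p q) (hq : Algebra.IsSmoothAt l q) :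
    Algebra.IsSmoothAt l p := by
  refine isSmoothAt_left_of_field' h (fun D _ _ _ hcomp _ _ => ?_) hq
  ext c
  have hf : algebraMap l A c = f (algebraMap l R₀ c) := (f.commutes c).symm
  have hg : algebraMap l B c = g (algebraMap l R₀ c) := (g.commutes c).symm
  rw [RingHom.comp_apply, RingHom.comp_apply, hf, hg]
  exact congrArg (fun φ : R₀ →+* D => φ (algebraMap l R₀ c)) hcomp

end AreSmoothEquivalent

end Literature.AlgebraicGeometry.Resolution

end
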